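import Summits.CriticalPhenomena.CardyFormulaZ2.Theorems.CardyBoundaryCoulombGasStripClusterRatesRectCardyOneArcs
import Summits.CriticalPhenomena.CardyFormulaZ2.Theorems.CardyBoundaryCoulombGasHalfPlaneMarkDensityLawBoxExhaustionPart2
import Literature.Probability.Percolation.CardyFormula
import Literature.Probability.Percolation.CrossingChains
import Literature.Probability.Percolation.RSW

/-!
# `RectilinearCardy → stub_rectCardyOne`, part 2b: the event dictionary for the box `(0,A)×(0,1)`

Support file for line `two-cluster-rate-is-stationary-gap` (crux `StripClusterRates`,
stmt-CriticalPhenomena-13878); continues `…StripClusterRatesRectBoxMesh` (part 1) and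
`…StripClusterRatesRectCardyOneArcs` (part 2a). For a conformal rectangle `R` whose carrier is the
open box `Ω = (0,A)×(0,1)` (integer aspect `A ≥ 1`) and whose crossing arcs `R.arc 0`, `R.arc 2` are
the left side `{0} × [0,1]` and the right side `{A} × [0,1]`, Smirnov's discretised crossing
probability at mesh `δ = 1/k` (`k ≥ 2`),
`bondDomainCrossingProb R (1/k) = P_{1/2}(C_δ(Ω; R.arc 0, R.arc 2))` (tree `CardyFormula.lean`,
`Crossings.lean`: a path of `Ω_δ`, open in `ω`, from the discrete arc of the left side to the
discrete arc of the right side), IS the left-right crossing probability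
`crossingProb half (A k − 2) (k − 2)` of the lattice rectangle `[0, Ak−2] × [0, k−2]`
(`rc_box_dictionary`, the registered stub). Ingredients:

* the mesh vertices of `Ω` at mesh `1/k` form the lattice box `{1,…,Ak−1} × {1,…,k−1}`, which is the
  translate `(1,1) + [0, Ak−2] × [0, k−2]` (`RectBox.image_rectangle_eq_meshVertices`), and
  `Ω_δ` is the nearest-neighbour graph on it (part 1);
* the discrete arc of the left side is the first column (part 2a, `RectBox.discreteArc_left`) and
  the discrete arc of the RIGHT side is the last column `v 0 = Ak − 1` (`RectBox.discreteArc_right`,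
  the mirror image, proved here), i.e. the translated `leftSide` / `rightSide`;
* hence on lattice configurations `ω ⊆ E(ℤ²)` (a `P_{1/2}`-a.s. set, `ae_subset_edgeSet`) the two
  events coincide (`RectBox.mem_discreteCrossing_box_iff`), and translation invariance
  (`bondPercolation_real_lrCrossingAt`) finishes.
No definitions are introduced.

References: S. Smirnov, C. R. Acad. Sci. Paris 333 (2001) 239, §2 [Smirnov2001];
G. Grimmett, *Percolation* (1999), §11.3 [Grimmett1999].
-/

noncomputable section

namespace Summit.CriticalPhenomena.CardyFormulaZ2.Cruxes.StripClusterRates.TwoClusterRateIsStationaryGap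

open Set Metric Complex MeasureTheory
open Literature.Probability.LatticeModels Literature.Probability.Percolation
open Summit.CriticalPhenomena.CardyFormulaZ2.Cruxes.HalfPlaneMarkDensityLaw.SketchLine
  (BoxExhaustion.openConnIn_meshDomain_of_reachable)

namespace RectBox

variable {A k : ℕ}

/-! ## The discrete arc of the right side -/

/-- **The discrete arc of the right side is the last column** `v 0 = Ak − 1` of the lattice box
(`k ≥ 2`, `A ≥ 1`); mirror image of `discreteArc_left`. [folklore] -/
theorem discreteArc_right (hA : 1 ≤ A) (hk : 2 ≤ k) (v : Site 2) :
    v ∈ discreteArc (Ioo (0 : ℝ) A ×ℂ Ioo (0 : ℝ) 1) (1 / (k : ℝ)) {z : ℂ | z.re = A ∧ z.im ∈ Icc (0 : ℝ) 1} ↔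
      v ∈ meshVertices (Ioo (0 : ℝ) A ×ℂ Ioo (0 : ℝ) 1) (1 / (k : ℝ)) ∧ v 0 + 1 = (A : ℤ) * k := by
  have hk1 : 1 ≤ k := le_trans (by norm_num) hk
  have hδ := mesh_pos (k := k) hk1
  have hAr : (0 : ℝ) < A := by exact_mod_cast hA
  have hkr : (0 : ℝ) < k := by exact_mod_cast hk1
  have hAk : (2 : ℤ) ≤ (A : ℤ) * k := by
    have : (1 : ℤ) * 2 ≤ (A : ℤ) * k := Int.mul_le_mul (by exact_mod_cast hA) (by exact_mod_cast hk)
      (by norm_num) (by positivity)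
    linarith
  set p := meshPoint (1 / (k : ℝ)) v with hp
  obtain ⟨hpre, hpim⟩ := meshPoint_coords (k := k) v
  -- `A - v₀/k = (A k - v₀)/k`
  have hsub : (A : ℝ) - (v 0 : ℝ) / k = ((A : ℝ) * k - v 0) / k := by
    field_simp
  constructor
  · rintro ⟨hvb, hdist⟩
    obtain ⟨hvV, wv, hadj, hwV⟩ := exists_adj_not_mem_of_mem_meshBoundary_obox hδ hvb
    have hvV' := (mem_meshVertices_brBox hk1).1 hvV
    refine ⟨hvV, ?_⟩
    -- real-coordinate consequences of the distance comparison
    have hv0r : (1 : ℝ) ≤ v 0 := by exact_mod_cast hvV'.1.1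
    have hv0r' : (v 0 : ℝ) + 1 ≤ A * k := by exact_mod_cast hvV'.1.2
    have hv1r : (1 : ℝ) ≤ v 1 := by exact_mod_cast hvV'.2.1
    have hv1r' : (v 1 : ℝ) + 1 ≤ k := by exact_mod_cast hvV'.2.2
    have hxI : p.re ∈ Ioo (0 : ℝ) A := by
      rw [hpre]; exact ⟨by positivity, by rw [div_lt_iff₀ hkr]; linarith⟩
    have hx : 0 ≤ p.re := hxI.1.le
    have hxA : p.re ≤ A := hxI.2.le
    have hy : p.im ∈ Icc (0 : ℝ) 1 := by
      rw [hpim]; exact ⟨by positivity, by rw [div_le_one hkr]; linarith⟩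
    rw [infDist_right_eq hxA hy] at hdist
    obtain ⟨hbf, -, hbR⟩ := foot_bottom_mem hAr hxI
    obtain ⟨htf, -, htR⟩ := foot_top_mem hAr hxI
    have hc1 : (A : ℝ) - p.re ≤ p.im :=
      (hdist.trans (infDist_le_dist_of_mem ⟨hbf, hbR⟩)).trans_eq (dist_foot_bottom p hy.1)
    have hc2 : (A : ℝ) - p.re ≤ 1 - p.im :=
      (hdist.trans (infDist_le_dist_of_mem ⟨htf, htR⟩)).trans_eq (dist_foot_top p hy.2)
    have hc3 : (A : ℝ) - p.re ≤ p.re :=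
      (hdist.trans (infDist_le_dist_of_mem (foot_left_mem hAr hy))).trans_eq (dist_foot_left p hx)
    rw [hpre, hpim, hsub] at hc1 hc2
    rw [hpre, hsub] at hc3
    have hc1' : (A : ℝ) * k - v 0 ≤ v 1 := by rwa [div_le_div_iff_of_pos_right hkr] at hc1
    have hc2' : (A : ℝ) * k - v 0 + v 1 ≤ k := by
      rw [le_sub_iff_add_le, ← add_div, div_le_one hkr] at hc2; exact hc2
    have hc3' : (A : ℝ) * k - v 0 ≤ v 0 := by rwa [div_le_div_iff_of_pos_right hkr] at hc3
    have hz1 : (A : ℤ) * k - v 0 ≤ v 1 := by exact_mod_cast hc1'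
    have hz2 : (A : ℤ) * k - v 0 + v 1 ≤ k := by exact_mod_cast hc2'
    have hz3 : (A : ℤ) * k - v 0 ≤ v 0 := by exact_mod_cast hc3'
    -- the missing neighbour
    rw [mem_meshVertices_brBox hk1] at hwV
    obtain ⟨i, hi | hi⟩ := (zdGraph_adj_iff v wv).1 hadj
    · fin_cases i
      · -- `wv = v + e₀` is outside: `v 0 + 1 = Ak`
        simp only [hi, Fin.zero_eta, Pi.add_apply, Pi.single_eq_same, ne_eq, one_ne_zero,
          not_false_eq_true, Pi.single_eq_of_ne, add_zero] at hwV
        omega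
      · -- `wv = v + e₁` is outside: `v 1 + 1 = k`
        simp only [hi, Fin.mk_one, Pi.add_apply, ne_eq, zero_ne_one, not_false_eq_true,
          Pi.single_eq_of_ne, add_zero, Pi.single_eq_same] at hwV
        omega
    · fin_cases i
      · have e0 : wv 0 = v 0 - 1 := by have := congr_fun hi 0; simp at this; omega
        have e1 : wv 1 = v 1 := by have := congr_fun hi 1; simpa using this.symm
        rw [e0, e1] at hwV
        omega
      · have e0 : wv 0 = v 0 := by have := congr_fun hi 0; simpa using this.symm
        have e1 : wv 1 = v 1 - 1 := by have := congr_fun hi 1; simp at this; omega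
        rw [e0, e1] at hwV
        omega
  · rintro ⟨hvV, hv0⟩
    have hvV' := (mem_meshVertices_brBox hk1).1 hvV
    have hv0r : (v 0 : ℝ) + 1 = A * k := by exact_mod_cast hv0
    have hv0r1 : (1 : ℝ) ≤ v 0 := by exact_mod_cast hvV'.1.1
    have hv1r : (1 : ℝ) ≤ v 1 := by exact_mod_cast hvV'.2.1
    have hv1r' : (v 1 : ℝ) + 1 ≤ k := by exact_mod_cast hvV'.2.2
    refine ⟨mem_meshBoundary_obox hδ hvV (w := v + Pi.single 0 1) ?_ ?_, ?_⟩
    · rw [zdGraph_adj_iff]; exact ⟨0, Or.inl rfl⟩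
    · rw [mem_meshVertices_brBox hk1]
      simp only [Pi.add_apply, Pi.single_eq_same]
      omega
    · have hxA : p.re ≤ A := by
        rw [hpre, div_le_iff₀ hkr]; nlinarith
      have hy : p.im ∈ Icc (0 : ℝ) 1 := by
        rw [hpim]; exact ⟨by positivity, by rw [div_le_one hkr]; linarith⟩
      rw [infDist_right_eq hxA hy]
      refine (le_infDist (frontier_diff_nonempty hAr).2).2 fun q hq ↦ le_trans ?_
        (le_dist_of_mem_frontier_diff_right hAr hq)
      have hval : (A : ℝ) - p.re = 1 / k := by
        rw [hpre, hsub]; congr 1; linarith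
      rw [hval, hpre, hpim]
      refine le_min ?_ (le_min ?_ ?_)
      · exact div_le_div_of_nonneg_right hv1r hkr.le
      · rw [le_sub_iff_add_le, ← add_div, div_le_one hkr]; linarith
      · exact div_le_div_of_nonneg_right hv0r1 hkr.le

/-! ## The lattice box as a translated lattice rectangle -/

/-- The translate `(1,1) + [0, Ak−2] × [0, k−2]` is the lattice box `{1,…,Ak−1} × {1,…,k−1}` = the mesh
vertices of `(0,A)×(0,1)` at mesh `1/k`. [folklore] -/
theorem image_rectangle_eq_meshVertices (hA : 1 ≤ A) (hk : 2 ≤ k) :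
    (· + (![1, 1] : Site 2)) '' (rectangle (A * k - 2) (k - 2) : Set (Site 2)) =
      meshVertices (Ioo (0 : ℝ) A ×ℂ Ioo (0 : ℝ) 1) (1 / (k : ℝ)) := by
  have hk1 : 1 ≤ k := le_trans (by norm_num) hk
  have hAk : 2 ≤ A * k := le_trans (by omega) (Nat.mul_le_mul hA hk)
  ext z
  rw [mem_image_rectangle_iff, mem_meshVertices_brBox hk1]
  simp only [Matrix.cons_val_zero, Matrix.cons_val_one, Nat.cast_sub hAk, Nat.cast_sub hk,
    Nat.cast_mul, Nat.cast_ofNat]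
  omega

/-- The translated left side is the first column of the lattice box. [folklore] -/
theorem mem_image_leftSide_iff (hA : 1 ≤ A) (hk : 2 ≤ k) {z : Site 2} :
    z ∈ (· + (![1, 1] : Site 2)) '' (leftSide (A * k - 2) (k - 2) : Set (Site 2)) ↔
      z ∈ meshVertices (Ioo (0 : ℝ) A ×ℂ Ioo (0 : ℝ) 1) (1 / (k : ℝ)) ∧ z 0 = 1 := by
  rw [← image_rectangle_eq_meshVertices hA hk]
  constructor
  · rintro ⟨b, hb, rfl⟩
    obtain ⟨hb1, hb2⟩ := Finset.mem_filter.1 (Finset.mem_coe.1 hb)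
    exact ⟨⟨b, Finset.mem_coe.2 hb1, rfl⟩, by simp [hb2]⟩
  · rintro ⟨⟨b, hb, rfl⟩, h0⟩
    refine ⟨b, Finset.mem_coe.2 (Finset.mem_filter.2 ⟨Finset.mem_coe.1 hb, ?_⟩), rfl⟩
    simpa using h0

/-- The translated right side is the last column of the lattice box. [folklore] -/
theorem mem_image_rightSide_iff (hA : 1 ≤ A) (hk : 2 ≤ k) {z : Site 2} :
    z ∈ (· + (![1, 1] : Site 2)) '' (rightSide (A * k - 2) (k - 2) : Set (Site 2)) ↔
      z ∈ meshVertices (Ioo (0 : ℝ) A ×ℂ Ioo (0 : ℝ) 1) (1 / (k : ℝ)) ∧ z 0 + 1 = (A : ℤ) * k := by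
  have hAk : 2 ≤ A * k := le_trans (by omega) (Nat.mul_le_mul hA hk)
  rw [← image_rectangle_eq_meshVertices hA hk]
  constructor
  · rintro ⟨b, hb, rfl⟩
    obtain ⟨hb1, hb2⟩ := Finset.mem_filter.1 (Finset.mem_coe.1 hb)
    refine ⟨⟨b, Finset.mem_coe.2 hb1, rfl⟩, ?_⟩
    simp only [Pi.add_apply, Matrix.cons_val_zero, hb2, Nat.cast_sub hAk, Nat.cast_mul, Nat.cast_ofNat]
    ring
  · rintro ⟨⟨b, hb, rfl⟩, h0⟩
    refine ⟨b, Finset.mem_coe.2 (Finset.mem_filter.2 ⟨Finset.mem_coe.1 hb, ?_⟩), rfl⟩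
    simp only [Pi.add_apply, Matrix.cons_val_zero] at h0
    rw [Nat.cast_sub hAk, Nat.cast_mul, Nat.cast_ofNat]
    omega

/-! ## The event dictionary -/

/-- **Event dictionary.** On a lattice configuration `ω ⊆ E(ℤ²)`, Smirnov's crossing event of the box
`(0,A)×(0,1)` at mesh `1/k` between its left and right sides is the left-right crossing event of the
translated lattice rectangle `(1,1) + [0, Ak−2] × [0, k−2]`. [folklore] -/
theorem mem_discreteCrossing_box_iff (hA : 1 ≤ A) (hk : 2 ≤ k) {ω : BondConfig (Site 2)}
    (hω : ω ⊆ (zdGraph 2).edgeSet) :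
    ω ∈ discreteCrossing (Ioo (0 : ℝ) A ×ℂ Ioo (0 : ℝ) 1) (1 / (k : ℝ))
        {z : ℂ | z.re = 0 ∧ z.im ∈ Icc (0 : ℝ) 1} {z : ℂ | z.re = A ∧ z.im ∈ Icc (0 : ℝ) 1} ↔
      ω ∈ lrCrossingAt ![1, 1] (A * k - 2) (k - 2) := by
  have hk1 : 1 ≤ k := le_trans (by norm_num) hk
  have hδ := mesh_pos (k := k) hk1
  rw [mem_discreteCrossing_iff, lrCrossingAt, mem_openCrossing_iff]
  constructor
  · rintro ⟨x, hx, y, hy, hr⟩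
    have hxD : x ∈ meshDomain (Ioo (0 : ℝ) A ×ℂ Ioo (0 : ℝ) 1) (1 / (k : ℝ)) :=
      meshBoundary_subset_meshDomain _ _ (discreteArc_subset_meshBoundary _ _ _ hx)
    have hconn := BoxExhaustion.openConnIn_meshDomain_of_reachable hxD hr
    rw [meshDomain_obox hδ, ← image_rectangle_eq_meshVertices hA hk] at hconn
    refine ⟨x, ?_, y, ?_, hconn⟩
    · exact (mem_image_leftSide_iff hA hk).2 ((discreteArc_left hA hk x).1 hx)
    · exact (mem_image_rightSide_iff hA hk).2 ((discreteArc_right hA hk y).1 hy)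
  · rintro ⟨x, hx, y, hy, hconn⟩
    rw [image_rectangle_eq_meshVertices hA hk] at hconn
    refine ⟨x, ?_, y, ?_, reachable_of_openConnIn_obox hδ hω hconn⟩
    · exact (discreteArc_left hA hk x).2 ((mem_image_leftSide_iff hA hk).1 hx)
    · exact (discreteArc_right hA hk y).2 ((mem_image_rightSide_iff hA hk).1 hy)

end RectBox

/-- Registered stub `rc_box_dictionary` of line `two-cluster-rate-is-stationary-gap`: for a conformal
rectangle with carrier the box `(0,A)×(0,1)` and crossing arcs its left and right sides, Smirnov's
discretised crossing probability at mesh `1/k` is the left-right crossing probability of the lattice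
rectangle `[0, Ak−2] × [0, k−2]` at `p = 1/2`. [folklore] -/
theorem rc_box_dictionary :
    ∀ (R : Literature.Probability.RandomPlanarGeometry.ConformalRectangle) (A k : ℕ), 1 ≤ A → 2 ≤ k →
      R.carrier = (Set.Ioo (0 : ℝ) A ×ℂ Set.Ioo (0 : ℝ) 1) →
      R.arc 0 = {z : ℂ | z.re = 0 ∧ z.im ∈ Set.Icc (0 : ℝ) 1} →
      R.arc 2 = {z : ℂ | z.re = A ∧ z.im ∈ Set.Icc (0 : ℝ) 1} →
      Literature.Probability.Percolation.bondDomainCrossingProb R (1 / (k : ℝ)) =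
        Literature.Probability.Percolation.crossingProb Literature.Probability.Percolation.half (A * k - 2) (k - 2) := by
  intro R A k hA hk hc h0 h2
  rw [bondDomainCrossingProb_eq_measureReal, hc, h0, h2,
    ← bondPercolation_real_lrCrossingAt half ![1, 1] (A * k - 2) (k - 2)]
  refine measureReal_congr ?_
  filter_upwards [ae_subset_edgeSet (zdGraph 2) half] with ω hω
  exact propext (RectBox.mem_discreteCrossing_box_iff hA hk hω)

end Summit.CriticalPhenomena.CardyFormulaZ2.Cruxes.StripClusterRates.TwoClusterRateIsStationaryGap

end
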